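import Summits.CriticalPhenomena.PercolationContinuityZ3.Theorems.PercNearOneGluingNoHeavyLowerTailMajorityGluingQCertSym3Blocks
import HarnessLib

/-!
# Fast cubic orbit keys III: `keyT = keyS3` and certificates digested with the fast key (lane prim-rate, constants-miner 1, gen 37; NEXT-g37 item 4)

Support file for the closed crux `NoHeavyLowerTail` (stmt-CriticalPhenomena-4575), majority-gluing line.  **`canonTc`**: the canonical code of an
ORIENTED triple in closed form from its seven popcounts (`canon3_eq_canonT`, via `…QCertSym3Blocks`); **`keyT`**: table popcounts (`popcT`), the
`orient3` comparisons, the closed form — and **`keyT_eq : keyT m i j k = keyS3 m i j k`** for all arguments, so nothing in the soundness chain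
(`…QCertSym3Sound/Perm/Count/Parts`) changes.  For certificates: `SymCert3.contribs3T/digest3T/checkQ3T/check3T` (the same lists filed under
`keyT`) with `digest3T_eq`, `check3T_eq`: a part proves `d.digest3 fuel = D` by `rw [← SymCert3.digest3T_eq]; decide +kernel` at ≈ 1/6 of the
kernel cost (2000 keys at `m = 10`: 37 s with `keyS3`, 6 s with `keyT`).  No sorries.
-/

namespace Summit.CriticalPhenomena.PercolationContinuityZ3.Theorems

namespace HubOnly
namespace QCert

/-! ### The closed-form canonical code and the fast key -/

/-- **Closed form of the canonical code of an ORIENTED triple** from the popcounts `|a|, |b|, |c|, |a∧b|, |a∧c|, |b∧c|, |a∧b∧c|`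
(indices `≥ 2^m` are kept fixed, as in `pull`). -/
def canonTc (m a b c pa pb pc pab pac pbc pabc : ℕ) : ℕ :=
  let M := 2 ^ m
  let q2 := pab - pabc
  let q3 := pac - pabc
  let q4 := (pa - pab) - (pac - pabc)
  let q5 := pbc - pabc
  let q6 := (pb - pab) - (pbc - pabc)
  let q7 := (pc - pac) - (pbc - pabc)
  let ap := if a < M then 2 ^ pa - 1 else a
  let bp := if b < M then (2 ^ pab - 1) + 2 ^ pab * (2 ^ (pa - pab) * (2 ^ (pb - pab) - 1)) else b
  let cp := if c < M then
      (2 ^ pabc - 1) + 2 ^ pabc * (2 ^ q2 * ((2 ^ q3 - 1) + 2 ^ q3 * (2 ^ q4 * ((2 ^ q5 - 1) + 2 ^ q5 * (2 ^ q6 * (2 ^ q7 - 1))))))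
    else c
  cp + (M + 1) * (bp + (M + 1) * ap)

/-- The closed form with the popcounts computed by `popc` (specification). -/
def canonT (m a b c : ℕ) : ℕ :=
  canonTc m a b c (popc m a) (popc m b) (popc m c) (popc m (a &&& b)) (popc m (a &&& c)) (popc m (b &&& c)) (popc m (a &&& b &&& c))

/-- **The closed form IS the canonical code** `canon3` (relabelling by `classList3`). -/
theorem canon3_eq_canonT (m a b c : ℕ) : canon3 m a b c = canonT m a b c := by
  obtain ⟨h0, h1, h2, h3, h4, h5, h6, h7, h8, h9, h10⟩ := block_lengths m a b c
  unfold canon3 canonT canonTc enc3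
  simp only []
  have ea : pull m (unrank3 m a b c) a = if a < 2 ^ m then 2 ^ popc m a - 1 else a := by
    split_ifs with ha
    · rw [pull_unrank3_a m a b c ha, h0]
    · exact pull_of_not_lt m _ ha
  have eb : pull m (unrank3 m a b c) b = if b < 2 ^ m then
      (2 ^ popc m (a &&& b) - 1) + 2 ^ popc m (a &&& b) * (2 ^ (popc m a - popc m (a &&& b)) * (2 ^ (popc m b - popc m (a &&& b)) - 1)) else b := by
    split_ifs with hb
    · rw [pull_unrank3_b m a b c hb, h1, h2, h3]
    · exact pull_of_not_lt m _ hb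
  have ec : pull m (unrank3 m a b c) c = if c < 2 ^ m then
      (2 ^ popc m (a &&& b &&& c) - 1) + 2 ^ popc m (a &&& b &&& c) * (2 ^ (popc m (a &&& b) - popc m (a &&& b &&& c)) *
        ((2 ^ (popc m (a &&& c) - popc m (a &&& b &&& c)) - 1) + 2 ^ (popc m (a &&& c) - popc m (a &&& b &&& c)) *
          (2 ^ ((popc m a - popc m (a &&& b)) - (popc m (a &&& c) - popc m (a &&& b &&& c))) *
            ((2 ^ (popc m (b &&& c) - popc m (a &&& b &&& c)) - 1) + 2 ^ (popc m (b &&& c) - popc m (a &&& b &&& c)) *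
              (2 ^ ((popc m b - popc m (a &&& b)) - (popc m (b &&& c) - popc m (a &&& b &&& c))) *
                (2 ^ ((popc m c - popc m (a &&& c)) - (popc m (b &&& c) - popc m (a &&& b &&& c))) - 1)))))) else c := by
    split_ifs with hc
    · rw [pull_unrank3_c m a b c hc, h4, h5, h6, h7, h8, h9, h10]
    · exact pull_of_not_lt m _ hc
  rw [ea, eb, ec]

/-- **The fast cubic orbit key**: table popcounts, orientation by the `tstat` comparisons, closed-form canonical code. -/
def keyT (m i j k : ℕ) : ℕ :=
  let pi := popcT m i
  let pj := popcT m j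
  let pk := popcT m k
  let pij := popcT m (i &&& j)
  let pik := popcT m (i &&& k)
  let pjk := popcT m (j &&& k)
  let pijk := popcT m (i &&& j &&& k)
  let si := (2 * m + 1) * pi + (pij + pik)
  let sj := (2 * m + 1) * pj + (pij + pjk)
  let sk := (2 * m + 1) * pk + (pik + pjk)
  if sj ≤ si then
    (if sk ≤ sj then canonTc m i j k pi pj pk pij pik pjk pijk
     else if sk ≤ si then canonTc m i k j pi pk pj pik pij pjk pijk
     else canonTc m k i j pk pi pj pik pjk pij pijk)
  else
    (if sk ≤ si then canonTc m j i k pj pi pk pij pjk pik pijk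
     else if sk ≤ sj then canonTc m j k i pj pk pi pjk pij pik pijk
     else canonTc m k j i pk pj pi pjk pik pij pijk)

/-- `orient3` with the conjunctions written in a fixed order. -/
theorem orient3_eq' (m i j k : ℕ) : orient3 m i j k =
    (if (2 * m + 1) * popc m j + (popc m (i &&& j) + popc m (j &&& k)) ≤ (2 * m + 1) * popc m i + (popc m (i &&& j) + popc m (i &&& k)) then
      (if (2 * m + 1) * popc m k + (popc m (i &&& k) + popc m (j &&& k)) ≤ (2 * m + 1) * popc m j + (popc m (i &&& j) + popc m (j &&& k)) then (i, j, k)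
        else if (2 * m + 1) * popc m k + (popc m (i &&& k) + popc m (j &&& k)) ≤ (2 * m + 1) * popc m i + (popc m (i &&& j) + popc m (i &&& k)) then (i, k, j)
        else (k, i, j))
    else
      (if (2 * m + 1) * popc m k + (popc m (i &&& k) + popc m (j &&& k)) ≤ (2 * m + 1) * popc m i + (popc m (i &&& j) + popc m (i &&& k)) then (j, i, k)
        else if (2 * m + 1) * popc m k + (popc m (i &&& k) + popc m (j &&& k)) ≤ (2 * m + 1) * popc m j + (popc m (i &&& j) + popc m (j &&& k)) then (j, k, i)
        else (k, j, i))) := by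
  unfold orient3 tstat
  rw [Nat.land_comm j i, Nat.land_comm k i, Nat.land_comm k j]

/-- **`keyT = keyS3`.** -/
theorem keyT_eq (m i j k : ℕ) : keyT m i j k = keyS3 m i j k := by
  have c1 : k &&& j = j &&& k := Nat.land_comm k j
  have c2 : k &&& i = i &&& k := Nat.land_comm k i
  have c3 : j &&& i = i &&& j := Nat.land_comm j i
  have a1 : i &&& k &&& j = i &&& j &&& k := by rw [Nat.land_assoc, Nat.land_comm k j, ← Nat.land_assoc]
  have a4 : j &&& k &&& i = i &&& j &&& k := by rw [Nat.land_comm (j &&& k) i, ← Nat.land_assoc]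
  unfold keyS3
  rw [orient3_eq']
  simp only [keyT, popcT_eq, canon3_eq_canonT]
  split_ifs <;> simp only [canonT, c1, c2, c3, a1, a4]

/-- `keyT = keyS3` as functions. -/
theorem keyT_eq_keyS3 : keyT = keyS3 := by
  funext m i j k; exact keyT_eq m i j k

/-! ### Certificates checked with the fast key -/

namespace SymCert3

variable (c : SymCert3)

/-- The fast key for this certificate's `m`. -/
abbrev keyF (i j k : ℕ) : ℕ := keyT c.base.m i j k

/-- `ell2C` with the fast key. -/
def ell2CT (e : ℕ × ℕ × ℕ) : List (ℕ × ℤ) :=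
  (c.keyF c.base.D e.1 e.2.1, (e.2.2 : ℤ) * c.base.cN) :: (suppOf c.NV c.base.tMem).map fun i => (c.keyF i e.1 e.2.1, -((e.2.2 : ℤ) * c.base.cD))

/-- `linC3` with the fast key. -/
def linC3T (e : ℕ × ℕ × ℕ × ℕ) : List (ℕ × ℤ) :=
  (c.keyF c.base.D e.2.1 e.2.2.1, -(e.2.2.2 : ℤ)) :: (suppOf c.NV (c.base.margMem e.1)).map fun i => (c.keyF i e.2.1 e.2.2.1, (e.2.2.2 : ℤ))

/-- `prodC3S` with the fast key. -/
def prodC3T (m1 m2 t : ℕ) (z : ℤ) : List (ℕ × ℤ) :=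
  ((suppOf c.NV (tb m1)).map fun i => (suppOf c.NV (tb m2)).map fun j => (c.keyF i j t, z)).flatten

/-- `rowC3S` with the fast key. -/
def rowC3T (r : RowE3) : List (ℕ × ℤ) := c.prodC3T r.row.m3 r.row.m4 r.t (-(r.row.n : ℤ)) ++ c.prodC3T r.row.m1 r.row.m2 r.t (r.row.n : ℤ)

/-- `sqC3S` with the fast key. -/
def sqC3T (s : SqE3) : List (ℕ × ℤ) :=
  ((suppOf c.NV (tb (s.sq.m1 ||| s.sq.m2))).map fun i =>
    (suppOf c.NV (tb (s.sq.m1 ||| s.sq.m2))).map fun j => (c.keyF i j s.t, -((s.sq.n : ℤ) * s.sq.u i * s.sq.u j))).flatten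

/-- **All contributions, filed under fast keys.** -/
def contribs3T : List (ℕ × ℤ) :=
  (c.ell2.map c.ell2CT).flatten ++ (c.lin.map c.linC3T).flatten ++
    (c.rows.map fun ch => (ch.map c.rowC3T).flatten).flatten ++ (c.sqs.map fun ch => (ch.map c.sqC3T).flatten).flatten

/-- The fast contribution list IS the contribution list. -/
theorem contribs3T_eq : c.contribs3T = c.contribs3S := by
  have h1 : c.ell2CT = c.ell2C := by
    funext e; simp only [ell2CT, ell2C, keyF, key, keyT_eq]
  have h2 : c.linC3T = c.linC3 := by
    funext e; simp only [linC3T, linC3, keyF, key, keyT_eq]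
  have h3 : c.prodC3T = c.prodC3S := by
    funext m1 m2 t z; simp only [prodC3T, prodC3S, keyF, key, keyT_eq]
  have h4 : c.rowC3T = c.rowC3S := by
    funext r; simp only [rowC3T, rowC3S, h3]
  have h5 : c.sqC3T = c.sqC3S := by
    funext s; simp only [sqC3T, sqC3S, keyF, key, keyT_eq]
  rw [contribs3T, contribs3S, h1, h2, h4, h5]

/-- **The digest computed with the fast key.** -/
def digest3T (fuel : ℕ) : List (ℕ × ℤ) := aggr (msort2 fuel c.contribs3T)

/-- It is the digest: a part may prove `d.digest3 fuel = D` by `rw [← SymCert3.digest3T_eq]; decide +kernel`. -/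
theorem digest3T_eq (fuel : ℕ) : c.digest3T fuel = c.digest3 fuel := by
  unfold digest3T digest3; rw [contribs3T_eq]

/-- **The key check with the fast key.** -/
def checkQ3T (fuel : ℕ) : Bool := runsOK (msort2 fuel c.contribs3T)

/-- It is the key check. -/
theorem checkQ3T_eq (fuel : ℕ) : c.checkQ3T fuel = c.checkQ3S fuel := by
  unfold checkQ3T checkQ3S; rw [contribs3T_eq]

/-- **The full check with the fast key** (`= check3S`). -/
def check3T (fuel : ℕ) : Bool := c.checkW3S && c.checkQ3T fuel

/-- It is the full check: a single-file certificate may prove `c.check3S fuel = true` by `rw [← SymCert3.check3T_eq]; decide +kernel`. -/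
theorem check3T_eq (fuel : ℕ) : c.check3T fuel = c.check3S fuel := by
  unfold check3T check3S; rw [checkQ3T_eq]

end SymCert3

/-! ### Smoke test -/

/-- The `(2,1)` smoke certificate of `…MajorityGluingQCertSym3` passes the FAST check. -/
theorem sym3Smoke_checkT : sym3Smoke.check3T 8 = true := by decide +kernel

/-- Fast keys agree with `keyS3` on sample triples at `m = 2` and `m = 10` (kernel evaluation of both). -/
theorem keyT_examples : keyT 2 1 2 4 = keyS3 2 1 2 4 ∧ keyT 2 4 1 2 = keyS3 2 4 1 2 ∧ keyT 2 3 1 1 = keyS3 2 3 1 1 ∧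
    keyT 10 837 1024 395 = keyS3 10 837 1024 395 ∧ keyT 10 1023 512 777 = keyS3 10 1023 512 777 := by
  decide +kernel

end QCert
end HubOnly

end Summit.CriticalPhenomena.PercolationContinuityZ3.Theorems
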